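import Literature.AlgebraicGeometry.Morphisms.FormalModuleCompletionCokernel
import Literature.AlgebraicGeometry.Morphisms.CohAffineExactness
import Mathlib.Algebra.Homology.ShortComplex.ShortExact
import HarnessLib

/-!
# The completion functor `ℱ ↦ ℱ^ = (ℱ/aⁿ⁺¹ℱ)_n` is additive; direct sums of coherent modules

Görtz–Wedhorn, *Algebraic Geometry II* (2023), Rem. and Def. 24.86 / (24.18.1) (p. 562): "We
obtain an additive functor `(𝒪_X-Mod) ⟶ (X_{/Z}-Mod)`, `ℱ ↦ ℱ_{/Z}`." In the tree's quotient model
(`Morphisms/FormalModuleCompletion`: `cmplMapApp`, `cmplMap`) this file records the additivity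
(`cmplMapApp_add/sub/neg`, `cmplMap_add/sub/neg/zero`), the resulting compatibility with direct sums
(`cmplMap_biprod_total`: `(fst ≫ inl)^ + (snd ≫ inr)^ = 𝟙` on `(M ⊞ N)^`), and that a direct sum of
coherent modules is coherent (`coh_biprod`, via the split exact sequence `0 → M → M ⊞ N → N → 0`).
These are the bookkeeping facts used to form the fibre product `G ×_{H/𝒦ᵉH} H` in the tricky
lemma of Grothendieck's existence theorem (The Stacks Project, Tag 088A).

Everything is proved; no named facts.

## References

* U. Görtz, T. Wedhorn, *Algebraic Geometry II: Cohomology of Schemes*, Springer Spektrum (2023),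
  Def. 24.86 and (24.18.1) (p. 562). [GortzWedhorn2023]
* The Stacks Project, Tag 088A. [StacksProject]
-/

noncomputable section

-- `TopCat.Presheaf`/`Scheme.Modules` are not reducible (as in Mathlib's `AlgebraicGeometry/Modules`).
set_option backward.isDefEq.respectTransparency false

open CategoryTheory AlgebraicGeometry Limits TopologicalSpace Opposite
open Literature.AlgebraicGeometry.Modules

universe u

namespace Literature.AlgebraicGeometry.Morphisms

variable {X : Scheme.{u}} (a : Γ(X, ⊤)) {M N : X.Modules}

/-! ### Additivity -/

/-- `(φ + ψ)^_n = φ^_n + ψ^_n`. [cite: GortzWedhorn2023, Def. 24.86 (p. 562)] -/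
theorem cmplMapApp_add (φ ψ : M ⟶ N) (n : ℕ) :
    cmplMapApp a (φ + ψ) n = cmplMapApp a φ n + cmplMapApp a ψ n := by
  rw [← cancel_epi (cmplπ a M n), cmplπ_cmplMapApp, Preadditive.comp_add, cmplπ_cmplMapApp,
    cmplπ_cmplMapApp, Preadditive.add_comp]

/-- `(-φ)^_n = -(φ^_n)`. [folklore] -/
theorem cmplMapApp_neg (φ : M ⟶ N) (n : ℕ) : cmplMapApp a (-φ) n = -cmplMapApp a φ n := by
  rw [← cancel_epi (cmplπ a M n), cmplπ_cmplMapApp, Preadditive.comp_neg, cmplπ_cmplMapApp,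
    Preadditive.neg_comp]

/-- `(φ - ψ)^_n = φ^_n - ψ^_n`. [folklore] -/
theorem cmplMapApp_sub (φ ψ : M ⟶ N) (n : ℕ) :
    cmplMapApp a (φ - ψ) n = cmplMapApp a φ n - cmplMapApp a ψ n := by
  rw [sub_eq_add_neg, cmplMapApp_add, cmplMapApp_neg, ← sub_eq_add_neg]

/-- `0^ = 0`. [folklore] -/
@[simp]
theorem cmplMap_zero : cmplMap a (0 : M ⟶ N) = 0 := by
  refine NatTrans.ext (funext fun k => ?_)
  obtain ⟨n⟩ := k
  rw [cmplMap_app, cmplMapApp_zero]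
  rfl

/-- **`(φ + ψ)^ = φ^ + ψ^`: the completion functor is additive.** [cite: GortzWedhorn2023, Def. 24.86 (p. 562)] -/
theorem cmplMap_add (φ ψ : M ⟶ N) : cmplMap a (φ + ψ) = cmplMap a φ + cmplMap a ψ := by
  refine NatTrans.ext (funext fun k => ?_)
  obtain ⟨n⟩ := k
  rw [cmplMap_app, cmplMapApp_add, NatTrans.app_add, cmplMap_app, cmplMap_app]

/-- `(-φ)^ = -φ^`. [folklore] -/
theorem cmplMap_neg (φ : M ⟶ N) : cmplMap a (-φ) = -cmplMap a φ := by
  refine NatTrans.ext (funext fun k => ?_)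
  obtain ⟨n⟩ := k
  rw [cmplMap_app, cmplMapApp_neg, NatTrans.app_neg, cmplMap_app]

/-- `(φ - ψ)^ = φ^ - ψ^`. [folklore] -/
theorem cmplMap_sub (φ ψ : M ⟶ N) : cmplMap a (φ - ψ) = cmplMap a φ - cmplMap a ψ := by
  rw [sub_eq_add_neg, cmplMap_add, cmplMap_neg, ← sub_eq_add_neg]

/-- **Completion respects direct sums**: `(fst ≫ inl)^ + (snd ≫ inr)^ = 𝟙` on `(M ⊞ N)^`. [folklore] -/
theorem cmplMap_biprod_total (M N : X.Modules) :
    cmplMap a (biprod.fst : M ⊞ N ⟶ M) ≫ cmplMap a biprod.inl +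
      cmplMap a (biprod.snd : M ⊞ N ⟶ N) ≫ cmplMap a biprod.inr = 𝟙 _ := by
  rw [← cmplMap_comp, ← cmplMap_comp, ← cmplMap_add, biprod.total, cmplMap_id]

/-- On sections: `z = inl^(fst^ z) + inr^(snd^ z)` for `z ∈ Γ(V, (M ⊞ N)/aⁿ⁺¹)`. [folklore] -/
theorem cmplMapApp_biprod_decomp (M N : X.Modules) (n : ℕ) (V : X.Opens)
    (z : Γ(cmplObj a (M ⊞ N) n, V)) :
    (cmplMapApp a (biprod.inl : M ⟶ M ⊞ N) n).app V ((cmplMapApp a (biprod.fst : M ⊞ N ⟶ M) n).app V z) +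
      (cmplMapApp a (biprod.inr : N ⟶ M ⊞ N) n).app V ((cmplMapApp a (biprod.snd : M ⊞ N ⟶ N) n).app V z) = z := by
  have h := congrArg (fun θ : cmplTower a (M ⊞ N) ⟶ cmplTower a (M ⊞ N) => (θ.app ⟨n⟩).app V z)
    (cmplMap_biprod_total a M N)
  simp only [NatTrans.app_add, NatTrans.comp_app, cmplMap_app, NatTrans.id_app] at h
  exact h

/-! ### Direct sums of coherent modules -/

/-- `0 → M → M ⊞ N → N → 0` is (split) short exact. [folklore] -/
theorem shortExact_biprod (M N : X.Modules) :
    (ShortComplex.mk (biprod.inl : M ⟶ M ⊞ N) (biprod.snd : M ⊞ N ⟶ N) biprod.inl_snd).ShortExact :=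
  (ShortComplex.Splitting.ofHasBinaryBiproduct M N).shortExact

/-- **A direct sum of coherent modules is coherent** (`X` locally noetherian). [folklore] -/
theorem coh_biprod [IsLocallyNoetherian X] (hM : Coh M) (hN : Coh N) : Coh (M ⊞ N) :=
  ⟨IsAffineLocalizing.of_shortExact₂ (shortExact_biprod M N) hM.loc hN.loc,
    IsAffineFiniteType.of_shortExact₂ (shortExact_biprod M N) hM.loc hM.ft hN.ft⟩

end Literature.AlgebraicGeometry.Morphisms

end
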